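import Mathlib
import HarnessLib
import Literature.Combinatorics.SimpleGraph.LasserreStableBound
import Literature.Combinatorics.SimpleGraph.RamseyNumbers
import Summits.PneNP.PneNP.Theses.RamseyUncertifiable
import Summits.PneNP.PneNP.Theorems.RamseyUncertifiableSosUncertaintyReductions

/-!
# Route `RamseyUncertifiable`, item `SosUncertainty` (stmt-PneNP-9815) — the conjecture lives in the
# Ramsey regime

`UP_t` (`SosUncertainty`) is trivially true, at EVERY level and with an explicit exponent, on graphs
with a bounded clique number or a bounded stability number: by Erdős–Szekeres (tree,
`exists_clique_or_indep_of_choose_le_card`) a `K_{a+1}`-free graph on `n` vertices has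
`α ≥ n^{1/a} − a`, and `α(G) ≤ las_t(G)`, `1 ≤ las_t(Gᶜ)`. This file records, sorry-free:

* `rpow_sub_le_indepNum_of_cliqueFree` — `n^{1/a} − a ≤ α(G)` for `K_{a+1}`-free `G` on `Fin n`;
* `uncertaintyProduct_ge_of_cliqueFree` / `…_of_compl_cliqueFree` — hence
  `n^{1/a} − a ≤ las_t(G) · las_t(Gᶜ)` whenever `ω(G) ≤ a` or `α(G) ≤ a` (`t, a ≥ 1`);
* `sosUncertainty_iff_of_le` — for every fixed `a ≥ 1`, `SosUncertainty` is EQUIVALENT to its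
  restriction to graphs with `ω(G) > a` and `α(G) > a`: the conjecture is a statement about graphs
  all of whose homogeneous sets are small on both sides (the Ramsey regime), exactly where no
  pseudo-expectation construction for arbitrary graphs is known.

[folklore; Erdős–Szekeres 1935]
-/

-- the Theorems namespace `Summit.PneNP.PneNP.Theorems` is prescribed by the tree layout
set_option linter.dupNamespace false

namespace Summit.PneNP.PneNP.Theorems.SosUncertainty

open Literature.Combinatorics.SimpleGraph Finset
open Summit.PneNP.PneNP.Theses.RamseyUncertifiable (SosUncertainty)

/-! ### Erdős–Szekeres for the stability number of a `K_{a+1}`-free graph -/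

/-- A `K_{a+1}`-free graph on `Fin n` with `C(a+b, a) ≤ n` has a stable `(b+1)`-set. -/
theorem exists_isNIndepSet_of_cliqueFree {n a b : ℕ} (G : SimpleGraph (Fin n))
    (hG : G.CliqueFree (a + 1)) (h : (a + b).choose a ≤ n) : ∃ s : Finset (Fin n), G.IsNIndepSet (b + 1) s := by
  rcases exists_clique_or_indep_of_choose_le_card G (a + b) a b rfl univ (by simpa using h) with
    ⟨s, -, hs⟩ | ⟨s, -, hs⟩
  · exact absurd hs (hG s)
  · exact ⟨s, (SimpleGraph.isNClique_compl G).1 hs⟩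

/-- Hence `b + 1 ≤ α(G)` under the same hypotheses. -/
theorem succ_le_indepNum_of_cliqueFree {n a b : ℕ} (G : SimpleGraph (Fin n))
    (hG : G.CliqueFree (a + 1)) (h : (a + b).choose a ≤ n) : b + 1 ≤ G.indepNum := by
  obtain ⟨s, hs⟩ := exists_isNIndepSet_of_cliqueFree G hG h
  have := hs.1.card_le_indepNum
  rwa [hs.2] at this

/-- **`α(G) ≥ n^{1/a} − a` for a `K_{a+1}`-free graph on `n` vertices** (`a ≥ 1`): take `b` largest
with `C(a+b, a) ≤ n`; then `α ≥ b + 1` and `n < C(a+b+1, a) ≤ (a+b+1)^a`. -/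
theorem rpow_sub_le_indepNum_of_cliqueFree {n a : ℕ} (ha : 1 ≤ a) (G : SimpleGraph (Fin n))
    (hG : G.CliqueFree (a + 1)) : (n : ℝ) ^ (1 / (a : ℝ)) - a ≤ (G.indepNum : ℝ) := by
  rcases Nat.eq_zero_or_pos n with rfl | hn
  · simp only [CharP.cast_eq_zero]
    rw [Real.zero_rpow (by positivity)]
    linarith [(Nat.cast_nonneg G.indepNum : (0 : ℝ) ≤ G.indepNum), (Nat.cast_nonneg a : (0 : ℝ) ≤ a)]
  · set b := Nat.findGreatest (fun b => (a + b).choose a ≤ n) n with hb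
    have hPb : (a + b).choose a ≤ n := by
      have h0 : (a + 0).choose a ≤ n := by simpa using (Nat.one_le_iff_ne_zero.2 hn.ne')
      exact Nat.findGreatest_spec (P := fun b => (a + b).choose a ≤ n) (Nat.zero_le n) h0
    have hα : b + 1 ≤ G.indepNum := succ_le_indepNum_of_cliqueFree G hG hPb
    -- `b < n`: a stable `(b+1)`-set fits in `Fin n`
    have hbn : b + 1 ≤ n := by
      obtain ⟨s, hs⟩ := exists_isNIndepSet_of_cliqueFree G hG hPb
      have := card_le_univ s
      rw [hs.2, Fintype.card_fin] at this
      exact this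
    -- maximality of `b`
    have hnot : ¬ (a + (b + 1)).choose a ≤ n :=
      Nat.findGreatest_is_greatest (P := fun b => (a + b).choose a ≤ n) (Nat.lt_succ_self b) hbn
    push Not at hnot
    have hlt : (n : ℝ) < ((a + b + 1 : ℕ) : ℝ) ^ (a : ℝ) := by
      rw [Real.rpow_natCast]
      have h1 : n < (a + (b + 1)) ^ a := hnot.trans_le (Nat.choose_le_pow _ _)
      have h2 : ((n : ℕ) : ℝ) < (((a + (b + 1)) ^ a : ℕ) : ℝ) := by exact_mod_cast h1
      simpa [add_assoc] using h2
    -- take `a`-th roots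
    have ha0 : (0 : ℝ) < a := by exact_mod_cast ha
    have hroot : (n : ℝ) ^ (1 / (a : ℝ)) < ((a + b + 1 : ℕ) : ℝ) := by
      have h := Real.rpow_lt_rpow (Nat.cast_nonneg n) hlt (by positivity : (0 : ℝ) < 1 / a)
      rwa [← Real.rpow_mul (Nat.cast_nonneg _), mul_one_div_cancel ha0.ne', Real.rpow_one] at h
    have hcast : ((a + b + 1 : ℕ) : ℝ) = a + (b + 1 : ℕ) := by push_cast; ring
    rw [hcast] at hroot
    have hα' : ((b + 1 : ℕ) : ℝ) ≤ (G.indepNum : ℝ) := by exact_mod_cast hα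
    linarith

/-! ### `UP_t` in the bounded-`ω` / bounded-`α` regime -/

/-- **`UP_t` for `K_{a+1}`-free graphs**: `n^{1/a} − a ≤ las_t(G) · las_t(Gᶜ)` for every level
`t ≥ 1`, every `a ≥ 1` and every `K_{a+1}`-free `G` on `Fin n`, `n ≥ 1` (via `α ≤ las_t(G)` and
`1 ≤ las_t(Gᶜ)`). -/
theorem uncertaintyProduct_ge_of_cliqueFree {t : ℕ} (ht : 1 ≤ t) {a : ℕ} (ha : 1 ≤ a) {n : ℕ}
    (hn : 1 ≤ n) (G : SimpleGraph (Fin n)) (hG : G.CliqueFree (a + 1)) :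
    (n : ℝ) ^ (1 / (a : ℝ)) - a ≤ lasserreStableBound G t * lasserreStableBound Gᶜ t := by
  have h1 := rpow_sub_le_indepNum_of_cliqueFree ha G hG
  have h2 := indepNum_le_lasserreStableBound G t ht
  have h3 : (1 : ℝ) ≤ lasserreStableBound Gᶜ t := one_le_lasserreStableBound hn Gᶜ ht
  have h4 : 0 ≤ lasserreStableBound G t := lasserreStableBound_nonneg G t ht
  calc (n : ℝ) ^ (1 / (a : ℝ)) - a ≤ lasserreStableBound G t := h1.trans h2
    _ = lasserreStableBound G t * 1 := (mul_one _).symm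
    _ ≤ lasserreStableBound G t * lasserreStableBound Gᶜ t := mul_le_mul_of_nonneg_left h3 h4

/-- **`UP_t` for graphs with `α ≤ a`** (complement `K_{a+1}`-free): the same bound, by the symmetry
`f_t(Gᶜ) = f_t(G)`. -/
theorem uncertaintyProduct_ge_of_compl_cliqueFree {t : ℕ} (ht : 1 ≤ t) {a : ℕ} (ha : 1 ≤ a) {n : ℕ}
    (hn : 1 ≤ n) (G : SimpleGraph (Fin n)) (hG : Gᶜ.CliqueFree (a + 1)) :
    (n : ℝ) ^ (1 / (a : ℝ)) - a ≤ lasserreStableBound G t * lasserreStableBound Gᶜ t := by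
  have h := uncertaintyProduct_ge_of_cliqueFree ht ha hn Gᶜ hG
  rwa [compl_compl, mul_comm] at h

/-- For `n ≥ (a+1)^{2a}` one has `n^{1/(2a)} ≤ n^{1/a} − a`. -/
theorem rpow_half_le_rpow_sub {a : ℕ} (ha : 1 ≤ a) {n : ℕ} (hn : (a + 1) ^ (2 * a) ≤ n) :
    (n : ℝ) ^ (1 / (2 * (a : ℝ))) ≤ (n : ℝ) ^ (1 / (a : ℝ)) - a := by
  have ha0 : (0 : ℝ) < a := by exact_mod_cast ha
  have hn0 : (0 : ℝ) ≤ n := Nat.cast_nonneg _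
  set x : ℝ := (n : ℝ) ^ (1 / (2 * (a : ℝ))) with hx
  -- `x ≥ a + 1`
  have hx1 : (a : ℝ) + 1 ≤ x := by
    have h1 : (((a + 1) ^ (2 * a) : ℕ) : ℝ) ≤ (n : ℝ) := by exact_mod_cast hn
    have h2 := Real.rpow_le_rpow (by positivity) h1 (by positivity : (0 : ℝ) ≤ 1 / (2 * a))
    have h3 : (((a + 1) ^ (2 * a) : ℕ) : ℝ) ^ (1 / (2 * (a : ℝ))) = a + 1 := by
      push_cast
      rw [← Real.rpow_natCast, ← Real.rpow_mul (by positivity)]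
      have : ((2 * a : ℕ) : ℝ) * (1 / (2 * (a : ℝ))) = 1 := by push_cast; field_simp
      rw [this, Real.rpow_one]
    rw [h3] at h2
    exact h2
  -- `x² = n^{1/a}`
  have hx2 : x ^ 2 = (n : ℝ) ^ (1 / (a : ℝ)) := by
    rw [hx, ← Real.rpow_natCast, ← Real.rpow_mul hn0]
    congr 1
    push_cast
    field_simp
  rw [← hx2]
  nlinarith [hx1, ha0]

/-- **The conjecture lives in the Ramsey regime.** For every fixed `a ≥ 1`, `SosUncertainty` is
equivalent to its restriction to graphs with a clique AND a stable set of size `a + 1`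
(`¬ G.CliqueFree (a+1) ∧ ¬ Gᶜ.CliqueFree (a+1)`): all other graphs satisfy `UP_t` at every level
with exponent `1/(2a)` by Erdős–Szekeres. -/
theorem sosUncertainty_iff_of_le {a : ℕ} (ha : 1 ≤ a) :
    SosUncertainty ↔ ∀ t : ℕ, 1 ≤ t → ∃ δ : ℝ, 0 < δ ∧ ∃ n₀ : ℕ, ∀ n ≥ n₀,
      ∀ G : SimpleGraph (Fin n), ¬ G.CliqueFree (a + 1) → ¬ Gᶜ.CliqueFree (a + 1) →
        (n : ℝ) ^ δ ≤ lasserreStableBound G t * lasserreStableBound Gᶜ t := by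
  refine ⟨fun h t ht => ?_, fun h t ht => ?_⟩
  · obtain ⟨δ, hδ, n₀, hn⟩ := h t ht
    exact ⟨δ, hδ, n₀, fun n hnn G _ _ => hn n hnn G⟩
  · obtain ⟨δ, hδ, n₀, hn⟩ := h t ht
    have ha0 : (0 : ℝ) < a := by exact_mod_cast ha
    refine ⟨min δ (1 / (2 * a)), lt_min hδ (by positivity), max n₀ ((a + 1) ^ (2 * a)), fun n hnn G => ?_⟩
    have hn₀ : n₀ ≤ n := le_of_max_le_left hnn
    have hN : (a + 1) ^ (2 * a) ≤ n := le_of_max_le_right hnn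
    have hn1 : 1 ≤ n := le_trans (Nat.one_le_pow _ _ (Nat.succ_pos a)) hN
    have hn1' : (1 : ℝ) ≤ n := by exact_mod_cast hn1
    by_cases hc : ¬ G.CliqueFree (a + 1) ∧ ¬ Gᶜ.CliqueFree (a + 1)
    · -- the Ramsey regime: the hypothesis, and `n^{min} ≤ n^δ`
      exact (Real.rpow_le_rpow_of_exponent_le hn1' (min_le_left _ _)).trans (hn n hn₀ G hc.1 hc.2)
    · -- a small `ω` or a small `α`: Erdős–Szekeres
      have hbound : (n : ℝ) ^ (1 / (a : ℝ)) - a ≤ lasserreStableBound G t * lasserreStableBound Gᶜ t := by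
        rw [not_and_or, not_not, not_not] at hc
        rcases hc with hc | hc
        · exact uncertaintyProduct_ge_of_cliqueFree ht ha hn1 G hc
        · exact uncertaintyProduct_ge_of_compl_cliqueFree ht ha hn1 G hc
      calc (n : ℝ) ^ min δ (1 / (2 * a)) ≤ (n : ℝ) ^ (1 / (2 * (a : ℝ))) :=
            Real.rpow_le_rpow_of_exponent_le hn1' (min_le_right _ _)
        _ ≤ (n : ℝ) ^ (1 / (a : ℝ)) - a := rpow_half_le_rpow_sub ha hN
        _ ≤ _ := hbound

/-- Registered form (sub-goal of stmt-PneNP-9815 for this file): `SosUncertainty` reduces to the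
Ramsey regime `ω > a ∧ α > a`, for every `a ≥ 1`. -/
theorem sosUncertainty_iff_ramseyRegime :
    ∀ {a : ℕ}, 1 ≤ a → (SosUncertainty ↔ ∀ t : ℕ, 1 ≤ t → ∃ δ : ℝ, 0 < δ ∧ ∃ n₀ : ℕ, ∀ n ≥ n₀,
      ∀ G : SimpleGraph (Fin n), ¬ G.CliqueFree (a + 1) → ¬ Gᶜ.CliqueFree (a + 1) →
        (n : ℝ) ^ δ ≤ lasserreStableBound G t * lasserreStableBound Gᶜ t) := by
  intro a ha
  exact sosUncertainty_iff_of_le ha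

end Summit.PneNP.PneNP.Theorems.SosUncertainty
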